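import Summits.CriticalPhenomena.PercolationContinuityZ3.Theorems.PercNearOneGluingNoHeavyPcintBFibTools
import HarnessLib

/-!
# PCINT lane, T-fibre route PHASE 3 (bond), step (4b): one step of the bond fibre process dominates `π_s`

Cell `prim-pcint`, seat `prim-pcint-1` (gen 13); memo `run/shared/lean/prim/pcint/T-FIBRE-ROUTE.md` (PHASE 3).

The analogue of `…PcintUFibDominating.lean`.  After the fibre factorisation (`BFib.StepB.fibB_mixG_iff`), one step of the
bond fibre process with selected parent `c ≠ o` of TYPE `H` (the usable set of the site `c` was entered from) reads: the layer
bits `h` of the entry edge are `π_p`-distributed CONDITIONED on `meetsU h H`, the internal bits `y` of `c` are fresh, the usable set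
is `U = grow y i` for one entry cell `i`, and the `k ≤ 5` children edges report i.i.d. bits with success probability
`1 - (1-p)^{#U}`.  With a growth rule whose size law `law` does not depend on the entry cell (hypothesis `hlaw`):

  `Σ_u pw(u) [meetsU h H] g(children) = π_p(meetsU · H) · Σ_u law(u) · E_{π_{1-(1-p)^u}}[g]`   (`sum_pw_step_pattern`),

so the TYPE DROPS OUT and step-wise domination (`BFib.dominating`) follows from the root inequality `s ≤ 1 - (1-p)^{#Φ}` and
the `15` tail inequalities `Σ_u law(u) · T_j(k, 1-(1-p)^u) ≥ T_j(k, s)` (`k ≤ 5`, count dominance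
`AdaptDom.mixture_dominates_of_tails`).
-/

noncomputable section

namespace Summit.CriticalPhenomena.PercolationContinuityZ3.Theorems.Pcint

namespace BFib

open Finset AdaptDom EdgeExpl UFib Literature.Probability.Percolation Literature.Probability.LatticeModels

variable {Φ : Type*} [Fintype Φ] [DecidableEq Φ] {Λ : Finset (Site 2)} {o : ↥Λ} {enc : ↥Λ → ℕ}
  (grow : (Φ × Φ → Bool) → Φ → Finset Φ) (p : ℝ) (law : ℕ → ℝ)
  (hlaw : ∀ (i : Φ) (G : ℕ → ℝ), ∑ y : Φ × Φ → Bool, wt p y * G (grow y i).card =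
    ∑ u ∈ range (Fintype.card Φ + 1), law u * G u)

/-! ### The one-step law of the bond process -/

omit [Fintype Φ] [DecidableEq Φ] in
/-- `υ` grows from an entry cell when the layer bits meet the type. -/
theorem υ_eq_grow_of_meetsU {h : Φ → Bool} {H : Finset Φ} (hm : (H.filter fun i => h i = true).Nonempty)
    (y : Φ × Φ → Bool) : υ grow h H y = grow y (Classical.choose hm) := by
  unfold υ; rw [dif_pos hm]

omit [Fintype Φ] [DecidableEq Φ] in
/-- The layer bits meet the type iff some cell of the type has an open layer bit. -/
theorem meetsU_iff_filter_nonempty (h : Φ → Bool) (H : Finset Φ) :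
    meetsU h H = true ↔ (H.filter fun i => h i = true).Nonempty := by
  rw [meetsU_eq_true_iff]
  constructor
  · rintro ⟨i, hi, hhi⟩; exact ⟨i, mem_filter.2 ⟨hi, hhi⟩⟩
  · rintro ⟨i, hi⟩; exact ⟨i, (mem_filter.1 hi).1, (mem_filter.1 hi).2⟩

include hlaw in
/-- **Integrating out the internal bits of the entered site**: the size law of `υ` does not depend on the entry cell. -/
theorem sum_wt_blk_card_υ {h : Φ → Bool} {H : Finset Φ} (hmeet : meetsU h H = true) (G : ℕ → ℝ) :
    ∑ t : Blk Φ, wt p t * G (υ grow h H (fun k => t (Sum.inl k))).card = ∑ u ∈ range (Fintype.card Φ + 1), law u * G u := by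
  have hm := (meetsU_iff_filter_nonempty h H).1 hmeet
  simp_rw [υ_eq_grow_of_meetsU grow hm]
  rw [sum_wt_blk_inl p (fun y => G (grow y (Classical.choose hm)).card)]
  exact hlaw _ G

variable {I : Type*} [Fintype I] [DecidableEq I] {A : Type*} [Fintype A] [DecidableEq A]

omit [Fintype Φ] [DecidableEq Φ] in
/-- Fubini for a triple sum with weights: move the outer integration variable inside. -/
theorem sum_swap3 {α β γ : Type*} [Fintype α] [Fintype β] [Fintype γ] (a : α → ℝ) (b : β → ℝ) (c d : γ → ℝ)
    (f : α → β → γ → ℝ) :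
    ∑ x, a x * ∑ y, b y * ∑ z, c z * (d z * f x y z) = ∑ z, c z * d z * ∑ y, b y * ∑ x, a x * f x y z := by
  simp_rw [Finset.mul_sum]
  rw [Finset.sum_congr rfl fun x _ => Finset.sum_comm, Finset.sum_comm]
  refine Finset.sum_congr rfl fun z _ => ?_
  rw [Finset.sum_comm]
  exact Finset.sum_congr rfl fun y _ => Finset.sum_congr rfl fun x _ => by ring


/-- **Patterns of i.i.d. layer reads are `π_r`-distributed** (edge-block version of `AdaptDom.sum_pw_pat_eq_sum_wt`): for a
block assignment on `A ⊕ I` and children `C ⊆ I` reading `meetsU (layer bits of block e) U`,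
`E[g(pattern)] = E_{π_{1-(1-p)^{#U}}}[g]`. -/
theorem sum_pw_layer_pattern (U : Finset Φ) (C : Finset I) {g : (I → Bool) → ℝ} (hg : StepTest C g) :
    ∑ u : (A ⊕ I) → Blk Φ, pw (fun _ => wt p) u *
        g (fun e => if e ∈ C then meetsU (fun i => u (Sum.inr e) (Sum.inr i)) U else false) =
      ∑ ω : I → Bool, wt (1 - (1 - p) ^ U.card) ω * g ω := by
  rw [sum_pw_comp_inr (wt p) (sum_wt p)
    (fun u' : I → Blk Φ => g (fun e => if e ∈ C then meetsU (fun i => u' e (Sum.inr i)) U else false))]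
  exact sum_pw_pat_eq_sum_wt (wt p) (sum_wt p) (1 - (1 - p) ^ U.card) (fun _ s => meetsU (fun i => s (Sum.inr i)) U) C
    (fun _ _ => sum_wt_blk_meetsU p U) g hg

include hlaw in
/-- **The one-step law, integrated**: with type `H`, entry-edge block `e₀ ∉ C`, site block `c`, children `C`:
`Σ_u pw(u) [meetsU (layer bits of e₀) H] g(pattern) = π_p(meetsU · H) · Σ_u law(u) E_{π_{1-(1-p)^u}}[g]`. -/
theorem sum_pw_step_pattern (H : Finset Φ) (c : A) (e₀ : I) (C : Finset I) (he₀ : e₀ ∉ C) {g : (I → Bool) → ℝ}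
    (hg : StepTest C g) :
    ∑ u : (A ⊕ I) → Blk Φ, pw (fun _ => wt p) u *
        ((if meetsU (fun i => u (Sum.inr e₀) (Sum.inr i)) H = true then (1 : ℝ) else 0) *
          g (fun e => if e ∈ C then meetsU (fun i => u (Sum.inr e) (Sum.inr i))
            (υ grow (fun i => u (Sum.inr e₀) (Sum.inr i)) H (fun k => u (Sum.inl c) (Sum.inl k))) else false)) =
      (∑ h : Φ → Bool, wt p h * (if meetsU h H = true then (1 : ℝ) else 0)) *
        ∑ n ∈ range (Fintype.card Φ + 1), law n * ∑ ω : I → Bool, wt (1 - (1 - p) ^ n) ω * g ω := by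
  classical
  -- integrate out the entry-edge block `e₀`
  rw [sum_pw_resample (fun _ => wt p) (fun _ => sum_wt p) (Sum.inr e₀)]
  have e1 : ∀ (u : (A ⊕ I) → Blk Φ) (s : Blk Φ),
      (if meetsU (fun i => Function.update u (Sum.inr e₀) s (Sum.inr e₀) (Sum.inr i)) H = true then (1 : ℝ) else 0) *
        g (fun e => if e ∈ C then meetsU (fun i => Function.update u (Sum.inr e₀) s (Sum.inr e) (Sum.inr i))
          (υ grow (fun i => Function.update u (Sum.inr e₀) s (Sum.inr e₀) (Sum.inr i)) H
            (fun k => Function.update u (Sum.inr e₀) s (Sum.inl c) (Sum.inl k))) else false) =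
      (if meetsU (fun i => s (Sum.inr i)) H = true then (1 : ℝ) else 0) *
        g (fun e => if e ∈ C then meetsU (fun i => u (Sum.inr e) (Sum.inr i))
          (υ grow (fun i => s (Sum.inr i)) H (fun k => u (Sum.inl c) (Sum.inl k))) else false) := by
    intro u s
    rw [Function.update_self, Function.update_of_ne (by simp)]
    congr 1
    refine hg.2 _ _ fun e he => ?_
    have hne : (Sum.inr e : A ⊕ I) ≠ Sum.inr e₀ := fun h => he₀ ((Sum.inr.inj h) ▸ he)
    rw [if_pos he, if_pos he, Function.update_of_ne hne]
  simp_rw [e1]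
  -- integrate out the site block `c`
  rw [sum_pw_resample (fun _ => wt p) (fun _ => sum_wt p) (Sum.inl c)]
  have e2 : ∀ (u : (A ⊕ I) → Blk Φ) (t s : Blk Φ),
      (if meetsU (fun i => s (Sum.inr i)) H = true then (1 : ℝ) else 0) *
        g (fun e => if e ∈ C then meetsU (fun i => Function.update u (Sum.inl c) t (Sum.inr e) (Sum.inr i))
          (υ grow (fun i => s (Sum.inr i)) H (fun k => Function.update u (Sum.inl c) t (Sum.inl c) (Sum.inl k))) else false) =
      (if meetsU (fun i => s (Sum.inr i)) H = true then (1 : ℝ) else 0) *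
        g (fun e => if e ∈ C then meetsU (fun i => u (Sum.inr e) (Sum.inr i))
          (υ grow (fun i => s (Sum.inr i)) H (fun k => t (Sum.inl k))) else false) := by
    intro u t s
    simp [Function.update_self]
  simp_rw [e2]
  rw [sum_swap3]
  simp_rw [sum_pw_layer_pattern p _ C hg]
  -- now: Σ_s wt s [meets s] Σ_t wt t E_{#υ(s,t)}[g]
  have e3 : ∀ s : Blk Φ, wt p s * (if meetsU (fun i => s (Sum.inr i)) H = true then (1 : ℝ) else 0) *
      ∑ t : Blk Φ, wt p t * ∑ ω : I → Bool,
        wt (1 - (1 - p) ^ (υ grow (fun i => s (Sum.inr i)) H (fun k => t (Sum.inl k))).card) ω * g ω =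
      wt p s * (if meetsU (fun i => s (Sum.inr i)) H = true then (1 : ℝ) else 0) *
        ∑ n ∈ range (Fintype.card Φ + 1), law n * ∑ ω : I → Bool, wt (1 - (1 - p) ^ n) ω * g ω := by
    intro s
    by_cases hm : meetsU (fun i => s (Sum.inr i)) H = true
    · rw [sum_wt_blk_card_υ grow p law hlaw hm (fun n => ∑ ω : I → Bool, wt (1 - (1 - p) ^ n) ω * g ω)]
    · rw [if_neg hm]; simp
  rw [Finset.sum_congr rfl fun s _ => e3 s, ← Finset.sum_mul,
    sum_wt_blk_inr p (fun h => if meetsU h H = true then (1 : ℝ) else 0)]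

/-- The same with `g ≡ 1`: `Σ_u pw(u) [meetsU (layer bits of e₀) H] = π_p(meetsU · H)`. -/
theorem sum_pw_meetsU_blk (H : Finset Φ) (e₀ : I) :
    ∑ u : (A ⊕ I) → Blk Φ, pw (fun _ => (wt p : Blk Φ → ℝ)) u * (if meetsU (fun i => u (Sum.inr e₀) (Sum.inr i)) H = true then (1 : ℝ) else 0) =
      ∑ h : Φ → Bool, wt p h * (if meetsU h H = true then (1 : ℝ) else 0) := by
  have h := sum_pw_mul_blind (fun (_ : A ⊕ I) => (wt p : Blk Φ → ℝ)) (fun _ => sum_wt p) (Sum.inr e₀)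
    (fun s => if meetsU (fun i => s (Sum.inr i)) H = true then (1 : ℝ) else 0) (fun _ => 1) (fun _ _ => rfl)
  simp only [mul_one] at h
  rw [h, sum_pw (fun _ => sum_wt p), mul_one]
  exact sum_wt_blk_inr p (fun h => if meetsU h H = true then (1 : ℝ) else 0)

/-! ### Fibre sums of the weight -/

variable (o enc) in
open Classical in
/-- **Fibre sums of `muB`**: on the fibre of a state equal to its own replay, the weight is the block prior times the
indicator of the fibre tests and of the root condition, up to the normalising constant. -/
theorem sum_fib_muB {n : ℕ} {σ : ↥(EΛ triGraph Λ) → Option Bool} (hcons : traj o enc σ n = σ)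
    (F : ((↥Λ ⊕ ↥(EΛ triGraph Λ)) → Blk Φ) → ℝ) :
    ∑ w ∈ univ.filter (fun w => run (rule o enc) (outB o enc grow w) n = σ), muB o p w * F w =
      (1 / wt p (blkAll : Blk Φ)) * ∑ w, pw (fun _ => wt p) w *
        ((if FibB o enc grow n σ w ∧ RootAll o w then (1 : ℝ) else 0) * F w) := by
  classical
  rw [Finset.sum_filter, Finset.mul_sum]
  refine Finset.sum_congr rfl fun w _ => ?_
  by_cases h : FibB o enc grow n σ w
  · rw [if_pos ((run_eq_iff_fibB o enc grow n σ w).2 ⟨hcons, h⟩)]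
    unfold muB
    by_cases hr : RootAll o w
    · rw [if_pos ((rootAll_iff o w).1 hr), if_pos ⟨h, hr⟩]; ring
    · rw [if_neg (fun h' => hr ((rootAll_iff o w).2 h')), if_neg (fun h' => hr h'.2)]; ring
  · rw [if_neg (fun h' => h ((run_eq_iff_fibB o enc grow n σ w).1 h').2), if_neg (fun h' => h h'.1)]; ring

/-! ### The general step -/

include hlaw in
open Classical in
/-- **Dominance at a general step** (context `X`): the fibre sum of `[fibre tests ∧ root condition] · g(children reports)`
dominates `E_{π_s}[g]` times the fibre mass, given the tail inequalities of the size law. -/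
theorem general_step (hp0 : 0 < p) (hp1 : p ≤ 1) {s : ℝ}
    (htable : ∀ k : ℕ, k ≤ 5 → ∀ j, 1 ≤ j → j ≤ k →
      (∑ u ∈ range (Fintype.card Φ + 1), law u) * binTail k s j ≤
        ∑ u ∈ range (Fintype.card Φ + 1), law u * binTail k (1 - (1 - p) ^ u) j)
    (i₀ : Φ) (X : StepB (Λ := Λ) o enc) {g : (↥(EΛ triGraph Λ) → Bool) → ℝ} (hg : StepTest X.C g) :
    (∑ w : (↥Λ ⊕ ↥(EΛ triGraph Λ)) → Blk Φ, pw (fun _ => wt p) w *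
        (if FibB o enc grow X.n X.σ w ∧ RootAll o w then (1 : ℝ) else 0)) * (∑ ω : ↥(EΛ triGraph Λ) → Bool, wt s ω * g ω) ≤
      ∑ w : (↥Λ ⊕ ↥(EΛ triGraph Λ)) → Blk Φ, pw (fun _ => wt p) w *
        ((if FibB o enc grow X.n X.σ w ∧ RootAll o w then (1 : ℝ) else 0) * g (outB o enc grow w X.σ)) := by
  classical
  have hp0' : 0 ≤ p := hp0.le
  have hoW : Sum.inl o ∉ X.W₀ := fun h => X.hco (X.inl_mem_W₀_iff.1 h).symm
  have hfac : ∀ u w : (↥Λ ⊕ ↥(EΛ triGraph Λ)) → Blk Φ,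
      (FibB o enc grow X.n X.σ (mixG X.W₀ u w) ∧ RootAll o (mixG X.W₀ u w)) ↔
        (X.FibRest (grow := grow) w ∧ RootAll o w) ∧ meetsU (hOf u X.e₀) (X.H (grow := grow) w) = true := by
    intro u w
    rw [X.fibB_mixG_iff u w]
    have hr : RootAll o (mixG X.W₀ u w) ↔ RootAll o w := by unfold RootAll; simp only [mixG_of_not_mem hoW]
    rw [hr]
    constructor
    · rintro ⟨⟨h1, h2⟩, h3⟩; exact ⟨⟨h1, h3⟩, h2⟩
    · rintro ⟨⟨h1, h3⟩, h2⟩; exact ⟨⟨h1, h2⟩, h3⟩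
  refine dominance_of_factorisation₃ (fun _ => wt p) (fun _ => sum_wt p) (fun _ x => wt_nonneg hp0' hp1 x) X.W₀
    (fun w => FibB o enc grow X.n X.σ w ∧ RootAll o w) (fun w => X.FibRest (grow := grow) w ∧ RootAll o w)
    (fun u w => meetsU (hOf u X.e₀) (X.H (grow := grow) w) = true)
    hfac _ (fun u w => g (fun e => if e ∈ X.C then meetsU (hOf u e) (υ grow (hOf u X.e₀) (X.H (grow := grow) w) (yOf u X.c))
      else false)) (fun u w _ => X.outB_mixG_children u w hg) _ fun w _ => ?_
  change (∑ u : (↥Λ ⊕ ↥(EΛ triGraph Λ)) → Blk Φ, pw (fun _ => wt p) u *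
      (if meetsU (fun i => u (Sum.inr X.e₀) (Sum.inr i)) (X.H (grow := grow) w) = true then (1 : ℝ) else 0)) * _ ≤
    ∑ u : (↥Λ ⊕ ↥(EΛ triGraph Λ)) → Blk Φ, pw (fun _ => wt p) u *
      ((if meetsU (fun i => u (Sum.inr X.e₀) (Sum.inr i)) (X.H (grow := grow) w) = true then (1 : ℝ) else 0) *
        g (fun e => if e ∈ X.C then meetsU (fun i => u (Sum.inr e) (Sum.inr i))
          (υ grow (fun i => u (Sum.inr X.e₀) (Sum.inr i)) (X.H (grow := grow) w) (fun k => u (Sum.inl X.c) (Sum.inl k)))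
          else false))
  rw [sum_pw_meetsU_blk p (X.H (grow := grow) w) X.e₀, sum_pw_step_pattern grow p law hlaw (X.H (grow := grow) w) X.c X.e₀ X.C
    X.e₀_not_mem_C hg]
  have hPm : 0 ≤ ∑ h : Φ → Bool, wt p h * (if meetsU h (X.H (grow := grow) w) = true then (1 : ℝ) else 0) :=
    Finset.sum_nonneg fun h _ => mul_nonneg (wt_nonneg hp0' hp1 h) (by split_ifs <;> norm_num)
  refine mul_le_mul_of_nonneg_left ?_ hPm
  -- the size law sums to one
  have hsum1 : ∑ u ∈ range (Fintype.card Φ + 1), law u = 1 := by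
    have h := hlaw i₀ (fun _ => 1)
    simp only [mul_one, sum_wt] at h
    exact h.symm
  have hk5 : X.C.card ≤ 5 := by have := X.card_C_succ_le; omega
  have hmix := mixture_dominates_of_tails (X := Fin (Fintype.card Φ + 1)) X.C (fun x => law x)
    (fun x => 1 - (1 - p) ^ (x : ℕ)) s (fun j hj1 hjk => by
      have := htable X.C.card hk5 j hj1 hjk
      rw [Finset.sum_range (fun u => law u), Finset.sum_range (fun u => law u * binTail X.C.card (1 - (1 - p) ^ u) j)] at this
      exact this) hg
  rw [Finset.sum_range (fun u => law u * ∑ ω : ↥(EΛ triGraph Λ) → Bool, wt (1 - (1 - p) ^ u) ω * g ω)]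
  have h1 : ∑ x : Fin (Fintype.card Φ + 1), law x = 1 := by rw [← Finset.sum_range (fun u => law u), hsum1]
  rw [h1, one_mul] at hmix
  exact hmix

/-! ### The theorem -/

include hlaw in
open Classical in
/-- **The bond fibre process dominates `π_s` step-wise** (hypothesis `hdom` of `AdaptDom.expect_le_of_dominating`), given
the root inequality and the `15` tail inequalities of the size law of the growth rule. -/
theorem dominating (hp0 : 0 < p) (hp1 : p ≤ 1) {s : ℝ} (hs0 : 0 < s) (hs1 : s ≤ 1)
    (hroot : s ≤ 1 - (1 - p) ^ Fintype.card Φ)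
    (htable : ∀ k : ℕ, k ≤ 5 → ∀ j, 1 ≤ j → j ≤ k →
      (∑ u ∈ range (Fintype.card Φ + 1), law u) * binTail k s j ≤
        ∑ u ∈ range (Fintype.card Φ + 1), law u * binTail k (1 - (1 - p) ^ u) j) (i₀ : Φ) :
    Dominating s (rule o enc) (muB o p) (outB o enc grow) := by
  classical
  have hp0' : 0 ≤ p := hp0.le
  have hs0' : 0 ≤ s := hs0.le
  intro n σ g hg
  have hwt1 : ∑ ω : ↥(EΛ triGraph Λ) → Bool, wt s ω = 1 := sum_wt _
  by_cases hcons : traj o enc σ n = σ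
  swap
  · have hfib : (univ.filter fun w : (↥Λ ⊕ ↥(EΛ triGraph Λ)) → Blk Φ =>
        run (rule o enc) (outB o enc grow w) n = σ) = ∅ := by
      ext w; simp only [Finset.mem_filter, Finset.mem_univ, true_and, Finset.notMem_empty, iff_false]
      exact fun h => hcons ((run_eq_iff_fibB o enc grow n σ w).1 h).1
    rw [hfib]; simp
  rw [show (∑ w ∈ univ.filter (fun w => run (rule o enc) (outB o enc grow w) n = σ), muB o p w) =
      ∑ w ∈ univ.filter (fun w => run (rule o enc) (outB o enc grow w) n = σ), muB o p w * 1 by simp only [mul_one]]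
  rw [sum_fib_muB o enc grow p hcons (fun _ => 1), sum_fib_muB o enc grow p hcons]
  simp only [mul_one]
  rw [mul_assoc]
  refine mul_le_mul_of_nonneg_left ?_ (div_nonneg zero_le_one (wt_blkAll_pos hp0).le)
  cases hsel : sel o enc σ with
  | none =>
    have hR := rule_of_sel_none (o := o) (enc := enc) hsel
    have hc : ∀ x : ↥(EΛ triGraph Λ) → Bool, g x = g (fun _ => false) := fun x => hg.2 _ _ fun v hv => by
      rw [hR] at hv; exact absurd hv (by simp)
    have e1 : ∑ ω : ↥(EΛ triGraph Λ) → Bool, wt s ω * g ω = g (fun _ => false) := by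
      rw [Finset.sum_congr rfl fun ω _ => by rw [hc ω], ← Finset.sum_mul, hwt1, one_mul]
    rw [e1, Finset.sum_mul]
    refine le_of_eq (Finset.sum_congr rfl fun w _ => ?_)
    rw [hc (outB o enc grow w σ)]; ring
  | some c =>
    by_cases hco : c = o
    · -- the origin step: product law with marginals `1 - (1-p)^{#Φ} ≥ s`
      rw [hco] at hsel
      have hoW : Sum.inl o ∉ (rule o enc σ).image (Sum.inr (α := ↥Λ)) := fun h => by
        obtain ⟨e, -, he⟩ := mem_image.1 h; exact absurd he (by simp)
      have hfac : ∀ u w : (↥Λ ⊕ ↥(EΛ triGraph Λ)) → Blk Φ,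
          (FibB o enc grow n σ (mixG ((rule o enc σ).image Sum.inr) u w) ∧
            RootAll o (mixG ((rule o enc σ).image Sum.inr) u w)) ↔ (FibB o enc grow n σ w ∧ RootAll o w) ∧ True := by
        intro u w
        rw [and_true, fibB_origin_mixG_iff hcons hsel u w]
        unfold RootAll; simp only [mixG_of_not_mem hoW]
      have hK : ∀ u w : (↥Λ ⊕ ↥(EΛ triGraph Λ)) → Blk Φ, True →
          g (outB o enc grow (mixG ((rule o enc σ).image Sum.inr) u w) σ) =
            g (fun e => if e ∈ rule o enc σ then meetsU (hOf u e) (rootU o w) else false) :=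
        fun u w _ => outB_origin_mixG_children hsel u w hg
      refine dominance_of_factorisation₃ (fun _ => wt p) (fun _ => sum_wt p) (fun _ x => wt_nonneg hp0' hp1 x)
        ((rule o enc σ).image Sum.inr) (fun w => FibB o enc grow n σ w ∧ RootAll o w)
        (fun w => FibB o enc grow n σ w ∧ RootAll o w) (fun _ _ => True) hfac _ _ hK _ fun w hTw => ?_
      simp only [if_true, one_mul, mul_one]
      rw [sum_pw (fun _ => sum_wt p), one_mul, rootU_of_rootAll hTw.2]
      change ∑ ω : ↥(EΛ triGraph Λ) → Bool, wt s ω * g ω ≤ ∑ u : (↥Λ ⊕ ↥(EΛ triGraph Λ)) → Blk Φ, pw (fun _ => wt p) u *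
        g (fun e => if e ∈ rule o enc σ then meetsU (fun i => u (Sum.inr e) (Sum.inr i)) (univ : Finset Φ) else false)
      rw [sum_pw_comp_inr (wt p) (sum_wt p)
        (fun u' : ↥(EΛ triGraph Λ) → Blk Φ => g (fun e => if e ∈ rule o enc σ then
          meetsU (fun i => u' e (Sum.inr i)) (univ : Finset Φ) else false))]
      refine sum_wt_le_sum_pw_pat (wt p) (fun x => wt_nonneg hp0' hp1 x) (sum_wt p) hs0' hs1
        (fun _ x => meetsU (fun i => x (Sum.inr i)) (univ : Finset Φ)) _ (fun e _ => ?_) g hg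
      rw [sum_wt_blk_meetsU p (univ : Finset Φ), Finset.card_univ]
      exact hroot
    · -- a general step: `c` was entered at step `k₀ < n` from `d` through `e₀`
      have hcr : c ∈ reached o (run (rule o enc) (readOut σ) n) := by
        have hc := hcons; unfold traj at hc; rw [hc]; exact (sel_reached hsel).1
      obtain ⟨k₀, hk₀, d, hseld, hent⟩ := exists_entry (readOut σ) hcr hco
      obtain ⟨e₀, he₀R, he₀, hx⟩ := hent
      have hσe₀ : σ e₀ = some true := by
        simp only [readOut] at hx
        cases hσ : σ e₀ with
        | none => rw [hσ] at hx; simp at hx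
        | some b => rw [hσ] at hx; simp only [Option.getD_some] at hx; rw [hx]
      exact general_step grow p law hlaw hp0 hp1 htable i₀
        ⟨n, σ, c, k₀, d, e₀, hcons, hsel, hco, hk₀, hseld, he₀R, he₀, hσe₀⟩ hg

end BFib

end Summit.CriticalPhenomena.PercolationContinuityZ3.Theorems.Pcint

end
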